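import Summits.BirchSwinnertonDyer.BirchSwinnertonDyer.Theorems.SoloInformedTameDepthEngine
import Literature.NumberTheory.EllipticCurves.PAdicLFunctionDistributionHoldsProofs
import Literature.NumberTheory.EllipticCurves.PAdicLFunctionProofs
import HarnessLib

/-!
# Tame depth of the order-`p` twisted value at a Kolyvagin pair (solo-informed study, C62)

Summit `BirchSwinnertonDyer`, solo-informed study, kernel files no. 18a–c (attempt A74, claim C62);
this is the main one.
Namespace `Summit.BirchSwinnertonDyer.BirchSwinnertonDyer.Theorems`; every declaration here is
proved (no named facts are introduced; Kim's structure theorem enters the last corollary only as the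
tree's hypothesis-`Prop` `Kim2022_selmerCorank_le_of_kuriharaNumber_ne_zero`).

## The statement

Let `f` be a weight-`2` newform on `Γ₀(N)` with rational coefficients, `[x]⁺ = ratPlusSymbol f x`
its rational plus modular symbol (period `Ω⁺_f`), `p` an odd prime, and `ℓ₁ ≠ ℓ₂` primes not
dividing `N` with `a_{ℓ₁} ≡ a_{ℓ₂} ≡ 2 (mod p)` — for an elliptic curve this is the congruence half
of "`ℓᵢ` is a Kolyvagin prime" (`ℓ ≡ 1`, `a_ℓ ≡ ℓ + 1 (mod p)`, `Kato.isKolyvaginPrime_one_iff`).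
Put `n = ℓ₁ ℓ₂`, assume the symbols `[a/n]⁺` are `p`-integral (automatic when `E[p]` is
irreducible, `IsNewformOf.not_dvd_den_ratPlusSymbol_div`), and let `ψ_ℓ : (ℤ/ℓ)ˣ → ℤ/p` be ANY
homomorphisms, `Ψ(a) = ψ_{ℓ₁}(a) + ψ_{ℓ₂}(a)`. The **twisted depth polynomial** is

  `T(X) = ∑_{a ∈ (ℤ/n)ˣ} \overline{[a/n]⁺} · (1 + X)^{Ψ(a)} ∈ 𝔽_p[X]`

(`soloTwistedDepthPolynomial`, file `SoloInformedTameDepthEngine`; the exponent is the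
representative of `Ψ(a)` in `[0, p)`).

**Theorem** (`solo_twistedDepthPolynomial_coeff`; divisibility form in
`SoloInformedTameDepthCurve`):
`coeff₀ T = 0`, `coeff₁ T = 0`, `coeff₂ T = δ_n`, the mod-`p` Kurihara number
`kuriharaNumber f p n ψ = ∑_a \overline{[a/n]⁺} ψ_{ℓ₁}(a) ψ_{ℓ₂}(a)`. Hence `X² ∣ T` always, and
`X³ ∣ T ↔ δ_n = 0`.

## Meaning: `δ_n ≠ 0` is the minimal `π`-adic depth of ONE twisted `L`-value

`T` is the image of the order-`p` twisted special value
`S = ∑_{a ∈ (ℤ/n)ˣ} [a/n]⁺ ζ_p^{Ψ(a)} = χ(θ̃_n) ∈ ℤ_{(p)}[ζ_p]` — the value of the Mazur–Tate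
modular element `θ̃_n = ∑_a [a/n]⁺ σ_a` (tree: `modularElement`, file
`MazurTateElementKuriharaCoefficient`) at the character `χ = ζ_p^{Ψ}` of `Gal(ℚ(μ_n)/ℚ) = (ℤ/n)ˣ`,
i.e. by Birch's formula (tree: `twisted_LValue_eq`, proved as `twisted_LValue_eq_holds`;
tree convention `τ(χ⁻¹) L(f, χ, 1) = ∑_{a mod m} χ⁻¹(a) {∞, a/m}_f`) the algebraic part
`± τ(χ) L(f, χ̄, 1) / Ω⁺_f` of a single twisted `L`-value (`χ` is even, of order `p`, and of
conductor `ℓ₁ ℓ₂` when both `ψ_ℓ` are non-trivial; the Galois conjugate `ζ_p ↦ ζ_p⁻¹` swaps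
`χ ↔ χ̄` and preserves `v_π`, so no valuation statement below depends on this choice) — under
the reduction
`ℤ_{(p)}[ζ_p] → ℤ_{(p)}[ζ_p]/(p) = 𝔽_p[X]/(X^{p-1})`, `ζ_p ↦ 1 + X`, `π = ζ_p - 1 ↦ X`
(well defined on exponents mod `p` because `(1+X)^p ≡ 1 (mod p, X^{p-1})`). Since
`(p) = (π)^{p-1}`, for `k ≤ p - 1` one has `v_π(S) ≥ k ↔ X^k ∣ (T mod X^{p-1})`. Consequently:

* `v_π(S) ≥ 2` always (`p ≥ 3`), and
* for `p ≥ 5`: `v_π(S) = 2 ↔ p ∤ δ_n`; i.e. **Kurihara's non-vanishing `δ_{ℓ₁ℓ₂} ≢ 0`, the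
  analytic input that pins `corank Sel_{p^∞} ≤ 2` (Kim 2022, Thm. 1.9; tree fact
  `Kim2022_selmerCorank_le_of_kuriharaNumber_ne_zero`, used in
  `solo_selmerCorank_le_two_of_not_cube_dvd`), is the statement that one order-`p` twisted
  `L`-value `L(E, χ, 1)` has the minimal possible `π`-adic valuation.** (For `p = 3` the
  polynomial identity still holds but `X²`, `X³` are invisible modulo `X^{p-1} = X²`.)

This is the "tame depth" formulation C62 of the solo-informed study (sharpest-statement §14–§16):
it converts the rank-`2` detection problem "find a Kolyvagin pair with `δ_n ≢ 0`" into a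
non-maximal-divisibility statement for twisted `L`-values by `(ζ_p - 1)³`, the shape in which
non-vanishing-mod-`𝔭` theorems for twisted `L`-values are usually stated.

## Proof

Write `φ̄(x) = \overline{[x]⁺}` (`soloSymbolModP`); it is `1`-periodic, and at a good prime `ℓ'`
the Hecke relation `a_{ℓ'} [x]⁺ = ∑_{j mod ℓ'} [(x+j)/ℓ']⁺ + [ℓ' x]⁺` (tree:
`intCast_mul_ratPlusSymbol`) survives reduction at the `p`-integral points `x = B/ℓ`
(`solo_hecke_modP`). The engine is the **projection (norm) formula** `solo_sum_units_mul_apply`: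
for `n = ℓ ℓ'`, `u = ℓ' mod ℓ` and any `c : (ℤ/ℓ)ˣ → R`,

  `∑_{a ∈ (ℤ/n)ˣ} φ(a/n) c(a mod ℓ) = a_{ℓ'} ∑_b φ(b/ℓ) c(b) - ∑_b φ(b/ℓ) (c(bu) + c(bu⁻¹))`,

proved from the fibre lemma `solo_sum_fiber` (the `ℓ'` points `(b/ℓ + j)/ℓ'` of the Hecke relation
at `x = b/ℓ` are the residues `a ≡ b (mod ℓ)` modulo `n`, all units except the single one
`a = ℓ' c`, `c ≡ ℓ'⁻¹ b`, whose symbol is `φ(bu⁻¹/ℓ)`, while `φ(ℓ' b/ℓ) = φ(bu/ℓ)`). With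
`a_{ℓ'} ≡ 2`: a constant `c` gives `∑_a φ̄(a/n) = 0`; an additive `c = ψ_ℓ` gives
`∑_a φ̄(a/n) ψ_ℓ(a) = 0`; and `c = ψ_ℓ (ψ_ℓ - 1)` gives `-2 ψ_ℓ(u)² ∑_b φ̄(b/ℓ)`, which vanishes by
the one-prime relation `∑_b φ̄(b/ℓ) = (a_ℓ - 2) φ̄(0) = 0` (`solo_sum_units_apply_div`). Expanding
`2·C(Ψ, 2) = Ψ(Ψ - 1) = ψ₁(ψ₁ - 1) + 2 ψ₁ ψ₂ + ψ₂(ψ₂ - 1)` leaves exactly `2 δ_n` for `2 coeff₂ T`.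
These are the Hecke/norm relations of the modular elements (Ota 2018, Prop. 2.3 (1); Mazur–Tate
1987, §1) that `MazurTateElementKuriharaCoefficient` records as "not here": that file proves the
ALGEBRAIC half (`θ ∈ I^j`, `j > ν(n)` ⟹ `δ_n = 0`, `kuriharaNumber_eq_zero_of_mem_augIdeal_pow`);
the present file proves, for `ν(n) = 2`, the ANALYTIC half along every order-`p` character:
the specialisation vanishes to order `2` with leading coefficient `δ_n`.

## Contents (three files)

* `SoloInformedTameDepthEngine` — form-free engine (any commutative ring `R`, any `1`-periodic
  `φ : ℚ → R` with the Hecke relations as hypotheses): `solo_sum_units_apply_div` (one prime),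
  `solo_sum_fiber`, `solo_sum_units_mul_apply` (projection formula),
  `solo_sum_units_mul_apply_of_shift`; and the definitions `soloSymbolModP`, `soloCharSum`,
  `soloTwistedDepthPolynomial` with `solo_coeff_twistedDepthPolynomial`.
* This file: `solo_ratCast_sum`, `solo_hecke_modP` (the Hecke relation survives reduction mod `p`
  at `p`-integral points), `soloCharSum_pair`, `solo_prod_primeFactors_pair`,
  **`solo_twistedDepthPolynomial_coeff`**.
* `SoloInformedTameDepthCurve`: `solo_X_pow_dvd_twistedDepthPolynomial` (`X² ∣ T`,
  `X³ ∣ T ↔ δ_n = 0`), `solo_twistedDepthPolynomial_coeff_of_isNewformOf` (elliptic curve,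
  `IsNewformOf W f`; hypotheses `p ≠ 2`, `E[p]` irreducible, `gcd(n, N) = 1`, good reduction and
  `a_{ℓᵢ}(E) ≡ 2 (mod p)` at `ℓ₁ ≠ ℓ₂`) and `solo_selmerCorank_le_two_of_not_cube_dvd`
  (`X³ ∤ T ⟹ corank Sel_{p^∞}(E/ℚ) ≤ 2`, with Kim's theorem as hypothesis).

Sources: [cite: Kurihara2014, §1.1 (PDF p. 2), displays (1)–(2)];
[cite: Kim2022StructureSelmer, §1.4 and Thm. 1.9 (PDF p. 7)]; [cite: MazurTate1987, §1];
Birch's formula as in the tree (`ModularSymbols.twisted_LValue_eq`).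
-/

noncomputable section

open scoped MatrixGroups ModularForm
open CongruenceSubgroup Polynomial
open Literature.NumberTheory.EllipticCurves Literature.NumberTheory.EllipticCurves.ModularForms

namespace Summit.BirchSwinnertonDyer.BirchSwinnertonDyer.Theorems

section CuspForm

variable {N : ℕ} (f : CuspForm (Gamma0 N) 2) (p : ℕ) [hp : Fact p.Prime]

/-- The cast `ℚ → 𝔽_p` is additive on finite sums of `p`-integral rationals (and the sum is again
`p`-integral). [folklore] -/
theorem solo_ratCast_sum {ι : Type*} (s : Finset ι) (q : ι → ℚ)
    (h : ∀ i ∈ s, ¬ p ∣ (q i).den) :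
    ¬ p ∣ (∑ i ∈ s, q i).den ∧
      (((∑ i ∈ s, q i : ℚ)) : ZMod p) = ∑ i ∈ s, ((q i : ℚ) : ZMod p) := by
  classical
  induction s using Finset.induction_on with
  | empty => simp [hp.out.ne_one]
  | insert a s ha ih =>
    have h1 : ¬ p ∣ (q a).den := h a (Finset.mem_insert_self a s)
    have ih' := ih (fun i hi => h i (Finset.mem_insert_of_mem hi))
    rw [Finset.sum_insert ha, Finset.sum_insert ha]
    refine ⟨fun hd => ?_, ?_⟩
    · rcases (Nat.Prime.dvd_mul hp.out).mp (hd.trans (Rat.add_den_dvd _ _)) with h2 | h2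
      · exact h1 h2
      · exact ih'.1 h2
    · rw [Rat.cast_add_of_ne_zero, ih'.2]
      · rw [ne_eq, ZMod.natCast_eq_zero_iff]; exact h1
      · rw [ne_eq, ZMod.natCast_eq_zero_iff]; exact ih'.1

/-- **Hecke relation mod `p`** for `φ̄(x) = \overline{[x]⁺} ∈ 𝔽_p` at the points `x = B/ℓ`,
for the good prime `ℓ' ∤ N` with `T_{ℓ'} f = a' f` and `n = ℓ ℓ'`:
`a' φ̄(B/ℓ) = ∑_{j mod ℓ'} φ̄((B/ℓ + j)/ℓ') + φ̄(ℓ' B/ℓ)`, from `intCast_mul_ratPlusSymbol` (all the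
symbols involved have denominator dividing `n`, hence are `p`-integral by `hint`). [folklore] -/
theorem solo_hecke_modP [NeZero N] (hf : IsNewform0 f) (hQ : coeffField f = ⊥) {ℓ ℓ' n : ℕ}
    [hℓ : Fact ℓ.Prime] [hℓ' : Fact ℓ'.Prime] (hn : n = ℓ * ℓ') (hℓ'N : ¬ ℓ' ∣ N) {a' : ℤ}
    (ha' : cuspCoeff f ℓ' = a') (hint : ∀ a : ℤ, ¬ p ∣ (ratPlusSymbol f ((a : ℚ) / n)).den)
    (B : ℕ) :
    (a' : ZMod p) * ((ratPlusSymbol f ((B : ℚ) / ℓ) : ℚ) : ZMod p) =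
      ∑ j : Fin ℓ', ((ratPlusSymbol f ((((B : ℚ) / ℓ) + j) / ℓ') : ℚ) : ZMod p) +
        ((ratPlusSymbol f (ℓ' * ((B : ℚ) / ℓ)) : ℚ) : ZMod p) := by
  haveI : NeZero ℓ' := ⟨hℓ'.out.ne_zero⟩
  have hℓ0 : (ℓ : ℚ) ≠ 0 := by exact_mod_cast hℓ.out.ne_zero
  have hℓ'0 : (ℓ' : ℚ) ≠ 0 := by exact_mod_cast hℓ'.out.ne_zero
  have hnQ : (n : ℚ) = ℓ * ℓ' := by rw [hn]; push_cast; ring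
  have H := intCast_mul_ratPlusSymbol ℓ' hf hℓ'.out hℓ'N ha' (ratCast_ratPlusSymbol_holds hf hQ)
    ((B : ℚ) / ℓ)
  have hden : ∀ (x : ℚ) (a : ℤ), x = (a : ℚ) / n → ¬ p ∣ (ratPlusSymbol f x).den := by
    rintro x a rfl; exact hint a
  have hne0 : ∀ (x : ℚ) (a : ℤ), x = (a : ℚ) / n → ((ratPlusSymbol f x).den : ZMod p) ≠ 0 := by
    intro x a hx; rw [ne_eq, ZMod.natCast_eq_zero_iff]; exact hden x a hx
  have d0 : ((B : ℚ) / ℓ) = ((ℓ' * B : ℤ) : ℚ) / n := by rw [hnQ]; push_cast; field_simp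
  have d1 : ∀ j : ℕ, (((B : ℚ) / ℓ) + j) / ℓ' = ((B + ℓ * j : ℤ) : ℚ) / n := by
    intro j; rw [hnQ]; push_cast; field_simp
  have d2 : (ℓ' : ℚ) * ((B : ℚ) / ℓ) = ((ℓ' * ℓ' * B : ℤ) : ℚ) / n := by
    rw [hnQ]; push_cast; field_simp
  have hS := solo_ratCast_sum p (Finset.univ : Finset (Fin ℓ'))
    (fun j : Fin ℓ' => ratPlusSymbol f ((((B : ℚ) / ℓ) + j) / ℓ'))
    (fun j _ => hden _ _ (d1 j))
  have c1 : ((((a' : ℚ) * ratPlusSymbol f ((B : ℚ) / ℓ)) : ℚ) : ZMod p) =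
      (a' : ZMod p) * ((ratPlusSymbol f ((B : ℚ) / ℓ) : ℚ) : ZMod p) := by
    rw [Rat.cast_mul_of_ne_zero (by simp) (hne0 _ _ d0), Rat.cast_intCast]
  have c2 : (((∑ j : Fin ℓ', ratPlusSymbol f ((((B : ℚ) / ℓ) + j) / ℓ') +
      ratPlusSymbol f (ℓ' * ((B : ℚ) / ℓ)) : ℚ)) : ZMod p) =
      ∑ j : Fin ℓ', ((ratPlusSymbol f ((((B : ℚ) / ℓ) + j) / ℓ') : ℚ) : ZMod p) +
        ((ratPlusSymbol f (ℓ' * ((B : ℚ) / ℓ)) : ℚ) : ZMod p) := by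
    rw [Rat.cast_add_of_ne_zero _ (hne0 _ _ d2), hS.2]
    rw [ne_eq, ZMod.natCast_eq_zero_iff]; exact hS.1
  have H' := congrArg (fun q : ℚ => (q : ZMod p)) H
  rwa [c1, c2] at H'

/-- At `n = ℓ₁ ℓ₂`: `Ψ(a) = ψ_{ℓ₁}(a mod ℓ₁) + ψ_{ℓ₂}(a mod ℓ₂)`. [folklore] -/
theorem soloCharSum_pair {ℓ₁ ℓ₂ n : ℕ} [NeZero n] (hℓ₁ : ℓ₁.Prime) (hℓ₂ : ℓ₂.Prime)
    (hn : n = ℓ₁ * ℓ₂) (hne : ℓ₁ ≠ ℓ₂) (h₁ : ℓ₁ ∣ n) (h₂ : ℓ₂ ∣ n)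
    (ψ : (ℓ : ℕ) → (ZMod ℓ)ˣ →* Multiplicative (ZMod p)) (a : (ZMod n)ˣ) :
    soloCharSum p n ψ a = Multiplicative.toAdd (ψ ℓ₁ (ZMod.unitsMap h₁ a)) +
      Multiplicative.toAdd (ψ ℓ₂ (ZMod.unitsMap h₂ a)) := by
  classical
  unfold soloCharSum
  have key : ∀ x ∈ n.primeFactors.attach,
      Multiplicative.toAdd (ψ x.1 (ZMod.unitsMap (Nat.dvd_of_mem_primeFactors x.2) a)) =
      (fun ℓ : ℕ => if h : ℓ ∣ n then Multiplicative.toAdd (ψ ℓ (ZMod.unitsMap h a)) else 0)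
        x.1 := by
    intro x _; simp only [dif_pos (Nat.dvd_of_mem_primeFactors x.2)]
  rw [Finset.sum_congr rfl key, Finset.sum_attach n.primeFactors
    (fun ℓ : ℕ => if h : ℓ ∣ n then Multiplicative.toAdd (ψ ℓ (ZMod.unitsMap h a)) else 0)]
  have hpf : n.primeFactors = {ℓ₁, ℓ₂} := by
    rw [hn, Nat.primeFactors_mul hℓ₁.ne_zero hℓ₂.ne_zero, hℓ₁.primeFactors, hℓ₂.primeFactors,
      ← Finset.insert_eq]
  rw [hpf, Finset.sum_pair hne, dif_pos h₁, dif_pos h₂]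

/-- At `n = ℓ₁ ℓ₂`: the product in `kuriharaNumber` is `ψ_{ℓ₁}(a mod ℓ₁) ψ_{ℓ₂}(a mod ℓ₂)`.
[folklore] -/
theorem solo_prod_primeFactors_pair {ℓ₁ ℓ₂ n : ℕ} [NeZero n] (hℓ₁ : ℓ₁.Prime) (hℓ₂ : ℓ₂.Prime)
    (hn : n = ℓ₁ * ℓ₂) (hne : ℓ₁ ≠ ℓ₂) (h₁ : ℓ₁ ∣ n) (h₂ : ℓ₂ ∣ n)
    (ψ : (ℓ : ℕ) → (ZMod ℓ)ˣ →* Multiplicative (ZMod p)) (a : (ZMod n)ˣ) :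
    ∏ ℓ ∈ n.primeFactors.attach,
        Multiplicative.toAdd (ψ ℓ.1 (ZMod.unitsMap (Nat.dvd_of_mem_primeFactors ℓ.2) a)) =
      Multiplicative.toAdd (ψ ℓ₁ (ZMod.unitsMap h₁ a)) *
        Multiplicative.toAdd (ψ ℓ₂ (ZMod.unitsMap h₂ a)) := by
  classical
  have key : ∀ x ∈ n.primeFactors.attach,
      Multiplicative.toAdd (ψ x.1 (ZMod.unitsMap (Nat.dvd_of_mem_primeFactors x.2) a)) =
      (fun ℓ : ℕ => if h : ℓ ∣ n then Multiplicative.toAdd (ψ ℓ (ZMod.unitsMap h a)) else 0)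
        x.1 := by
    intro x _; simp only [dif_pos (Nat.dvd_of_mem_primeFactors x.2)]
  rw [Finset.prod_congr rfl key, Finset.prod_attach n.primeFactors
    (fun ℓ : ℕ => if h : ℓ ∣ n then Multiplicative.toAdd (ψ ℓ (ZMod.unitsMap h a)) else 0)]
  have hpf : n.primeFactors = {ℓ₁, ℓ₂} := by
    rw [hn, Nat.primeFactors_mul hℓ₁.ne_zero hℓ₂.ne_zero, hℓ₁.primeFactors, hℓ₂.primeFactors,
      ← Finset.insert_eq]
  rw [hpf, Finset.prod_pair hne, dif_pos h₁, dif_pos h₂]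

/-- **Tame depth at a Kolyvagin pair** (C62 of the solo-informed study). Let `f` be a rational
weight-`2` newform of level `N`, `p` an odd prime, `ℓ₁ ≠ ℓ₂` primes not dividing `N` with
`a_{ℓ₁} ≡ a_{ℓ₂} ≡ 2 (mod p)` (no condition `ℓᵢ ≡ 1 (mod p)` is needed), `n = ℓ₁ ℓ₂`, all symbols
`[a/n]⁺` `p`-integral, and `ψ_ℓ : (ℤ/ℓ)ˣ → ℤ/p` any homomorphisms. Then the twisted depth
polynomial `T(X) = ∑_{a ∈ (ℤ/n)ˣ} \overline{[a/n]⁺} (1+X)^{ψ_{ℓ₁}(a) + ψ_{ℓ₂}(a)} ∈ 𝔽_p[X]` has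
`coeff₀ T = 0`, `coeff₁ T = 0` and `coeff₂ T = δ_n` (the mod-`p` Kurihara number): `X² ∣ T`, and
`X³ ∣ T ↔ δ_n = 0`. Proof: the Hecke relations at `ℓ₂` (resp. `ℓ₁`) project the sum of
`\overline{[a/n]⁺} c(a mod ℓ₁)` onto level `ℓ₁` (`solo_sum_units_mul_apply`), where `a_ℓ ≡ 2`
kills everything but the mixed term `∑ \overline{[a/n]⁺} ψ_{ℓ₁}(a) ψ_{ℓ₂}(a) = δ_n`. -/
theorem solo_twistedDepthPolynomial_coeff [NeZero N] (hf : IsNewform0 f)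
    (hQ : coeffField f = ⊥) (hp2 : p ≠ 2) {ℓ₁ ℓ₂ n : ℕ} [hℓ₁ : Fact ℓ₁.Prime]
    [hℓ₂ : Fact ℓ₂.Prime] [NeZero n] (hn : n = ℓ₁ * ℓ₂) (hne : ℓ₁ ≠ ℓ₂) (hℓ₁N : ¬ ℓ₁ ∣ N)
    (hℓ₂N : ¬ ℓ₂ ∣ N) {a₁ a₂ : ℤ} (ha₁ : cuspCoeff f ℓ₁ = a₁) (ha₂ : cuspCoeff f ℓ₂ = a₂)
    (ha₁p : (a₁ : ZMod p) = 2) (ha₂p : (a₂ : ZMod p) = 2)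
    (hint : ∀ a : ℤ, ¬ p ∣ (ratPlusSymbol f ((a : ℚ) / n)).den)
    (ψ : (ℓ : ℕ) → (ZMod ℓ)ˣ →* Multiplicative (ZMod p)) :
    (soloTwistedDepthPolynomial f p n ψ).coeff 0 = 0 ∧
      (soloTwistedDepthPolynomial f p n ψ).coeff 1 = 0 ∧
      (soloTwistedDepthPolynomial f p n ψ).coeff 2 = kuriharaNumber f p n ψ := by
  classical
  have hℓ₁p : ℓ₁.Prime := hℓ₁.out
  have hℓ₂p : ℓ₂.Prime := hℓ₂.out
  have h₁ : ℓ₁ ∣ n := ⟨ℓ₂, hn⟩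
  have hn' : n = ℓ₂ * ℓ₁ := by rw [hn, mul_comm]
  have h₂ : ℓ₂ ∣ n := ⟨ℓ₁, hn'⟩
  have hp20 : (2 : ZMod p) ≠ 0 := by
    intro h
    have h' : ((2 : ℕ) : ZMod p) = 0 := by exact_mod_cast h
    rw [ZMod.natCast_eq_zero_iff] at h'
    exact hp2 ((Nat.prime_dvd_prime_iff_eq hp.out Nat.prime_two).mp h')
  -- the reduced symbol and its periodicity
  have hper : ∀ (q : ℚ) (z : ℤ), soloSymbolModP f p (q + z) = soloSymbolModP f p q :=
    soloSymbolModP_add_intCast f p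
  -- the units `u₁ = ℓ₂ mod ℓ₁`, `u₂ = ℓ₁ mod ℓ₂`
  have hu₁' : IsUnit ((ℓ₂ : ZMod ℓ₁)) := (ZMod.isUnit_prime_iff_not_dvd hℓ₂p).mpr
    (fun h => hne ((Nat.prime_dvd_prime_iff_eq hℓ₂p hℓ₁p).mp h).symm)
  have hu₂' : IsUnit ((ℓ₁ : ZMod ℓ₂)) := (ZMod.isUnit_prime_iff_not_dvd hℓ₁p).mpr
    (fun h => hne ((Nat.prime_dvd_prime_iff_eq hℓ₁p hℓ₂p).mp h))
  have hu₁ : ((hu₁'.unit : (ZMod ℓ₁)ˣ) : ZMod ℓ₁) = (ℓ₂ : ZMod ℓ₁) := hu₁'.unit_spec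
  have hu₂ : ((hu₂'.unit : (ZMod ℓ₂)ˣ) : ZMod ℓ₂) = (ℓ₁ : ZMod ℓ₂) := hu₂'.unit_spec
  -- Hecke relations mod `p` with `a_{ℓᵢ} ≡ 2`
  have H₂ : ∀ b : (ZMod ℓ₁)ˣ, (2 : ZMod p) * soloSymbolModP f p (((b : ZMod ℓ₁).val : ℚ) / ℓ₁) =
      ∑ j : Fin ℓ₂, soloSymbolModP f p (((((b : ZMod ℓ₁).val : ℚ) / ℓ₁) + j) / ℓ₂) +
        soloSymbolModP f p (ℓ₂ * ((((b : ZMod ℓ₁).val : ℚ) / ℓ₁))) := by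
    intro b
    have := solo_hecke_modP f p hf hQ hn hℓ₂N ha₂ hint (b : ZMod ℓ₁).val
    rw [ha₂p] at this
    exact this
  have H₁ : ∀ b : (ZMod ℓ₂)ˣ, (2 : ZMod p) * soloSymbolModP f p (((b : ZMod ℓ₂).val : ℚ) / ℓ₂) =
      ∑ j : Fin ℓ₁, soloSymbolModP f p (((((b : ZMod ℓ₂).val : ℚ) / ℓ₂) + j) / ℓ₁) +
        soloSymbolModP f p (ℓ₁ * ((((b : ZMod ℓ₂).val : ℚ) / ℓ₂))) := by
    intro b
    have := solo_hecke_modP f p hf hQ hn' hℓ₁N ha₁ hint (b : ZMod ℓ₂).val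
    rw [ha₁p] at this
    exact this
  have H₁0 : (2 : ZMod p) * soloSymbolModP f p 0 =
      ∑ j : Fin ℓ₁, soloSymbolModP f p (((0 : ℚ) + j) / ℓ₁) + soloSymbolModP f p (ℓ₁ * 0) := by
    have := solo_hecke_modP f p hf hQ hn' hℓ₁N ha₁ hint 0
    rw [ha₁p] at this
    simp only [Nat.cast_zero, zero_div] at this
    exact this
  have H₂0 : (2 : ZMod p) * soloSymbolModP f p 0 =
      ∑ j : Fin ℓ₂, soloSymbolModP f p (((0 : ℚ) + j) / ℓ₂) + soloSymbolModP f p (ℓ₂ * 0) := by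
    have := solo_hecke_modP f p hf hQ hn hℓ₂N ha₂ hint 0
    rw [ha₂p] at this
    simp only [Nat.cast_zero, zero_div] at this
    exact this
  -- one-prime sums vanish: `∑_b φ̄(b/ℓᵢ) = (aᵢ - 2) φ̄(0) = 0`
  have G₁ : ∑ b : (ZMod ℓ₁)ˣ, soloSymbolModP f p (((b : ZMod ℓ₁).val : ℚ) / ℓ₁) = 0 := by
    rw [solo_sum_units_apply_div (soloSymbolModP f p) ℓ₁ 2 H₁0]; ring
  have G₂ : ∑ b : (ZMod ℓ₂)ˣ, soloSymbolModP f p (((b : ZMod ℓ₂).val : ℚ) / ℓ₂) = 0 := by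
    rw [solo_sum_units_apply_div (soloSymbolModP f p) ℓ₂ 2 H₂0]; ring
  -- characters are additive
  have hadd : ∀ (ℓ : ℕ) (b v : (ZMod ℓ)ˣ), Multiplicative.toAdd (ψ ℓ (b * v)) =
      Multiplicative.toAdd (ψ ℓ b) + Multiplicative.toAdd (ψ ℓ v) := by
    intro ℓ b v; rw [map_mul, toAdd_mul]
  have hinv : ∀ (ℓ : ℕ) (v : (ZMod ℓ)ˣ), Multiplicative.toAdd (ψ ℓ v⁻¹) =
      - Multiplicative.toAdd (ψ ℓ v) := by
    intro ℓ v; rw [map_inv, toAdd_inv]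
  -- (E0) `∑_a φ̄(a/n) = 0`
  have E0 : ∑ a : (ZMod n)ˣ, soloSymbolModP f p ((((a : ZMod n)).val : ℚ) / n) = 0 := by
    have := solo_sum_units_mul_apply_of_shift (soloSymbolModP f p) hper hn hne h₁ 2 H₂
      hu₁'.unit hu₁ (fun _ => (1 : ZMod p)) 0 (fun b => by ring)
    simp only [mul_one, sub_self, zero_mul] at this
    exact this
  -- (E1) `∑_a φ̄(a/n) ψ_{ℓᵢ}(a) = 0`
  have E1a : ∑ a : (ZMod n)ˣ, soloSymbolModP f p ((((a : ZMod n)).val : ℚ) / n) *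
      Multiplicative.toAdd (ψ ℓ₁ (ZMod.unitsMap h₁ a)) = 0 := by
    have := solo_sum_units_mul_apply_of_shift (soloSymbolModP f p) hper hn hne h₁ 2 H₂
      hu₁'.unit hu₁ (fun b => Multiplicative.toAdd (ψ ℓ₁ b)) 0
      (fun b => by simp only [hadd, hinv]; ring)
    simp only [sub_self, zero_mul] at this
    exact this
  have E1b : ∑ a : (ZMod n)ˣ, soloSymbolModP f p ((((a : ZMod n)).val : ℚ) / n) *
      Multiplicative.toAdd (ψ ℓ₂ (ZMod.unitsMap h₂ a)) = 0 := by
    have := solo_sum_units_mul_apply_of_shift (soloSymbolModP f p) hper hn' hne.symm h₂ 2 H₁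
      hu₂'.unit hu₂ (fun b => Multiplicative.toAdd (ψ ℓ₂ b)) 0
      (fun b => by simp only [hadd, hinv]; ring)
    simp only [sub_self, zero_mul] at this
    exact this
  -- (E2) `∑_a φ̄(a/n) q(ψ_{ℓᵢ}(a)) = -2 ψ(u)² ∑_b φ̄(b/ℓᵢ) = 0`, `q(x) = x (x - 1)`
  have E2a : ∑ a : (ZMod n)ˣ, soloSymbolModP f p ((((a : ZMod n)).val : ℚ) / n) *
      (Multiplicative.toAdd (ψ ℓ₁ (ZMod.unitsMap h₁ a)) *
        (Multiplicative.toAdd (ψ ℓ₁ (ZMod.unitsMap h₁ a)) - 1)) = 0 := by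
    have := solo_sum_units_mul_apply_of_shift (soloSymbolModP f p) hper hn hne h₁ 2 H₂
      hu₁'.unit hu₁
      (fun b => Multiplicative.toAdd (ψ ℓ₁ b) * (Multiplicative.toAdd (ψ ℓ₁ b) - 1))
      (2 * Multiplicative.toAdd (ψ ℓ₁ hu₁'.unit) ^ 2)
      (fun b => by simp only [hadd, hinv]; ring)
    rw [G₁] at this
    simp only [sub_self, zero_mul, mul_zero] at this
    exact this
  have E2b : ∑ a : (ZMod n)ˣ, soloSymbolModP f p ((((a : ZMod n)).val : ℚ) / n) *
      (Multiplicative.toAdd (ψ ℓ₂ (ZMod.unitsMap h₂ a)) *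
        (Multiplicative.toAdd (ψ ℓ₂ (ZMod.unitsMap h₂ a)) - 1)) = 0 := by
    have := solo_sum_units_mul_apply_of_shift (soloSymbolModP f p) hper hn' hne.symm h₂ 2 H₁
      hu₂'.unit hu₂
      (fun b => Multiplicative.toAdd (ψ ℓ₂ b) * (Multiplicative.toAdd (ψ ℓ₂ b) - 1))
      (2 * Multiplicative.toAdd (ψ ℓ₂ hu₂'.unit) ^ 2)
      (fun b => by simp only [hadd, hinv]; ring)
    rw [G₂] at this
    simp only [sub_self, zero_mul, mul_zero] at this
    exact this
  -- (K) the mixed term is the Kurihara number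
  have K : ∑ a : (ZMod n)ˣ, soloSymbolModP f p ((((a : ZMod n)).val : ℚ) / n) *
      (Multiplicative.toAdd (ψ ℓ₁ (ZMod.unitsMap h₁ a)) *
        Multiplicative.toAdd (ψ ℓ₂ (ZMod.unitsMap h₂ a))) = kuriharaNumber f p n ψ := by
    rw [kuriharaNumber_eq_sum_ratCast f p n ψ]
    refine Finset.sum_congr rfl fun a _ => ?_
    rw [solo_prod_primeFactors_pair p hℓ₁p hℓ₂p hn hne h₁ h₂ ψ a]
    rfl
  -- the exponent
  have hΨ : ∀ a : (ZMod n)ˣ, ((soloCharSum p n ψ a).val : ZMod p) =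
      Multiplicative.toAdd (ψ ℓ₁ (ZMod.unitsMap h₁ a)) +
        Multiplicative.toAdd (ψ ℓ₂ (ZMod.unitsMap h₂ a)) := by
    intro a; rw [ZMod.natCast_zmod_val, soloCharSum_pair p hℓ₁p hℓ₂p hn hne h₁ h₂ ψ a]
  refine ⟨?_, ?_, ?_⟩
  · -- constant coefficient
    rw [solo_coeff_twistedDepthPolynomial]
    simp only [Nat.choose_zero_right, Nat.cast_one, mul_one]
    exact E0
  · -- linear coefficient
    rw [solo_coeff_twistedDepthPolynomial]
    simp only [Nat.choose_one_right, hΨ, mul_add, Finset.sum_add_distrib]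
    rw [E1a, E1b, add_zero]
  · -- quadratic coefficient: `2 coeff₂ = ∑ φ̄ Ψ(Ψ-1) = E2a + 2 K + E2b`
    rw [solo_coeff_twistedDepthPolynomial]
    apply mul_left_cancel₀ hp20
    rw [Finset.mul_sum]
    have step : ∀ a : (ZMod n)ˣ,
        (2 : ZMod p) * (soloSymbolModP f p ((((a : ZMod n)).val : ℚ) / n) *
          (((soloCharSum p n ψ a).val.choose 2 : ℕ) : ZMod p)) =
        soloSymbolModP f p ((((a : ZMod n)).val : ℚ) / n) *
          (Multiplicative.toAdd (ψ ℓ₁ (ZMod.unitsMap h₁ a)) *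
            (Multiplicative.toAdd (ψ ℓ₁ (ZMod.unitsMap h₁ a)) - 1)) +
        2 * (soloSymbolModP f p ((((a : ZMod n)).val : ℚ) / n) *
          (Multiplicative.toAdd (ψ ℓ₁ (ZMod.unitsMap h₁ a)) *
            Multiplicative.toAdd (ψ ℓ₂ (ZMod.unitsMap h₂ a)))) +
        soloSymbolModP f p ((((a : ZMod n)).val : ℚ) / n) *
          (Multiplicative.toAdd (ψ ℓ₂ (ZMod.unitsMap h₂ a)) *
            (Multiplicative.toAdd (ψ ℓ₂ (ZMod.unitsMap h₂ a)) - 1)) := by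
      intro a
      rw [mul_left_comm, solo_two_mul_cast_choose_two p, hΨ a]
      ring
    rw [Finset.sum_congr rfl fun a _ => step a, Finset.sum_add_distrib, Finset.sum_add_distrib,
      ← Finset.mul_sum, E2a, K, E2b, zero_add, add_zero]

end CuspForm

end Summit.BirchSwinnertonDyer.BirchSwinnertonDyer.Theorems

end
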